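import Summits.CriticalPhenomena.CardyFormulaZ2.Theses.CardyRotToConf
import Summits.CriticalPhenomena.CardyFormulaZ2.Theses.CardySelfRefinement
import Summits.CriticalPhenomena.CardyFormulaZ2.Theorems.CardyRotToConfR2SymmetryUpgrade.Negative.CardyRotToConfR2SymmetryUpgradeFalseOfFacts
import Summits.CriticalPhenomena.CardyFormulaZ2.Theorems.CardyRotToConfR2SymmetryUpgradeNoTracedLine
import Summits.CriticalPhenomena.CardyFormulaZ2.Theorems.CardyRotToConfR2SymmetryUpgradeSleNoEarlyTarget
import Summits.CriticalPhenomena.CardyFormulaZ2.Theorems.CardyRotToConfR2SymmetryUpgradeSleRangeNull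
import Summits.CriticalPhenomena.CardyFormulaZ2.Theorems.CardyRotToConfR2SymmetryUpgradeFatDomain
import Summits.CriticalPhenomena.CardyFormulaZ2.Theorems.CardyRotToConfR2SymmetryUpgradeFatSurgeryChordal
import Summits.CriticalPhenomena.CardyFormulaZ2.Theorems.CardyRotToConfR2SymmetryUpgradeFatSurgerySimilarity
import Summits.CriticalPhenomena.CardyFormulaZ2.Theorems.CardyRotToConfR2SymmetryUpgradeFatSurgeryLocal
import Summits.CriticalPhenomena.CardyFormulaZ2.Theorems.CardyRotToConfR2SymmetryUpgradeFatSurgeryTI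
import Summits.CriticalPhenomena.CardyFormulaZ2.Theorems.CardyRotToConfR2SymmetryUpgradeFatSurgeryWitness
import Summits.CriticalPhenomena.CardyFormulaZ2.Theorems.CardyRotToConfR2SymmetryUpgradeMarkovCore
import Literature.Topology.PlaneTopology.OsgoodArc
import HarnessLib

/-!
# `¬ CardyRotToConfR2SymmetryUpgrade`: the typed crux r2 of route CardyRotToConf (= crux
# `SymmetryUpgrade` of route CardySelfRefinement, stmt-CriticalPhenomena-0698) is false

The crux asserts: every chordal curve family `P` that is similarity covariant, domain Markov,
local (restriction form) and target independent (splitting form), and whose curves do not trace the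
boundary, is the family of chordal SLE₆ laws. It is refuted by TWO admissible non-tracing families
that differ on one Dobrushin domain (`Negative.not_crux_of_two_families`: under the crux both laws
would be the unique SLE₆ law).

* **Family one**: a family `Q` of chordal SLE₆ laws (exists, Rohde–Schramm,
  `Negative.exists_sleSixLawFamily'`). Its admissibility is a theorem of the tree
  (`Negative.isLocalMarkovChordalFamily_of_isSLELaw_six_of_facts` fed with the PROVED locality
  theorems `IsSLELaw.locality_six_holds` — Lawler–Schramm–Werner 2001 Thm 2.2 / Cor 2.4 — and
  `sle_six_moebius_locality_holds` — Lawler 2005 Thm 6.13; chordality, conformal hence similarity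
  covariance, and the typed domain Markov property `ChordalFamily.isDomainMarkov_of_isSLELaw`),
  and so is non-tracing (`stub_nonTracing`).
* **Family two**: the FAT-GERM ONE-SHOT SURGERY `J = Negative.fatSurgery Q` of `Q`
  (`Negative/SurgFatFamily`): in a Dobrushin domain `(D; a, b)` whose germ at `a` FIRES — both
  boundary branches at `a` have positive planar Lebesgue measure in every neighbourhood and `D`
  contains near `a` exactly one open half-disc — the curve is the straight chord from `a` along the
  half-disc normal up to its first boundary point `q`, followed (if `q ≠ b`) by an independent
  `Q`-curve of the crosscut domain `(D_b; q, b)`; all other domains keep their `Q`-law. `J` is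
  chordal and non-tracing (`stub_fatSurgeryChordal`), similarity covariant
  (`stub_fatSurgerySimilarity`), local (`stub_fatSurgeryLocal`), target independent
  (`stub_fatSurgeryTI`) and domain Markov (`stub_fatSurgeryMarkovCore`, using that SLE₆ traces no
  straight segment `stub_sleSixNoTracedSegment`, has Lebesgue-null range `stub_sleRangeNull`, and
  reaches its target only at the end `stub_sleNoEarlyTarget`; the kernel conflicts are null by
  generalized tip separation `stub_tipSeparationGen` and the slit-trace lemma `stub_slitTrace`).
* **They differ** on the fat example domain built from an Osgood arc (`exists_osgoodArc`,
  `stub_fatDomain`): it fires with the chord landing at `b`, so `J` is the Dirac mass at the chord,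
  which the segment-free `Q` does not charge (`stub_fatSurgeryWitness`).

Verdict for the planners: REFUTED-MISSTATED. The witness is a similarity-covariant, Markov, local,
target-independent, non-tracing family with a DETERMINISTIC STRAIGHT initial phase at fat germs; it
exploits the absence, in the typed statement, of the informal clause (iv) "arises as a subsequential
scaling limit of the ℤ² interfaces (RSW-type a priori bounds)" — equivalently of an "instant
two-sided boundary return" / domain-continuity hypothesis (E4/E5 of the ideators' `Sketch.lean`).
A repaired statement `C′` adds such a clause; the fat surgery violates instant return at every
firing germ (its curve leaves `a` along a segment), so it misses `C′`.
-/

/-- **Record of the dropped route item `SymmetryUpgrade`** = stmt-CriticalPhenomena-0698 (ledger signature verbatim; NOT a route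
item): route CardySelfRefinement rev 12 (2026-08-16T23:02Z) dropped the refuted `SymmetryUpgrade` and restated Assembly through `SymmetryUpgradeR`. The declaration `Summit.CriticalPhenomena.CardyFormulaZ2.Theses.CardySelfRefinement.SymmetryUpgrade`
therefore no longer exists in the route file and this accepted module stopped elaborating (stale olean;
buildfix lane 2026-08-19). Re-created here under its original name so the result keeps building; the
statement of every previously accepted declaration in this file is unchanged. -/
def _root_.Summit.CriticalPhenomena.CardyFormulaZ2.Theses.CardySelfRefinement.SymmetryUpgrade : Prop :=
  ∀ P : Literature.Probability.RandomPlanarGeometry.ChordalFamily, Literature.Probability.RandomPlanarGeometry.IsLocalMarkovChordalFamily P → (∀ D : Literature.Probability.RandomPlanarGeometry.DobrushinDomain, ∀ᵐ γ ∂(P D), ∀ c : Literature.Probability.RandomPlanarGeometry.Curve ℂ, Literature.Probability.RandomPlanarGeometry.CurveClass.mk c = γ → ∀ s t : unitInterval, s < t → c '' Set.Icc s t ⊆ frontier D.carrier → (c '' Set.Icc s t).Subsingleton) → ∀ D : Literature.Probability.RandomPlanarGeometry.DobrushinDomain, Literature.Probability.RandomPlanarGeometry.IsSLELaw 6 D (P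 D)


noncomputable section

open Set MeasureTheory Topology Filter Metric
open scoped unitInterval ENNReal NNReal

namespace Summit.CriticalPhenomena.CardyFormulaZ2.Theorems

open Literature.Probability.RandomPlanarGeometry
open Literature.Probability.RandomPlanarGeometry.ChordalFamily
open Summit.CriticalPhenomena.CardyFormulaZ2.Theorems.CardyRotToConfR2SymmetryUpgrade
open Summit.CriticalPhenomena.CardyFormulaZ2.Theorems.CardyRotToConfR2SymmetryUpgrade.Negative

/-- **A second admissible non-tracing family**: for any family `Q` of chordal SLE₆ laws, its
fat-germ one-shot surgery is admissible, non-tracing, and differs from `Q` on some Dobrushin domain.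
[folklore] -/
theorem exists_admissible_nonTracing_ne_of_isSLELaw_six {Q : ChordalFamily}
    (hQ : ∀ D : DobrushinDomain, IsSLELaw 6 D (Q D)) :
    ∃ J : ChordalFamily, IsLocalMarkovChordalFamily J ∧
      (∀ D : DobrushinDomain, ∀ᵐ γ ∂(J D), ∀ c : Curve ℂ, CurveClass.mk c = γ →
        ∀ s t : unitInterval, s < t → c '' Set.Icc s t ⊆ frontier D.carrier →
          (c '' Set.Icc s t).Subsingleton) ∧
      ∃ D : DobrushinDomain, J D ≠ Q D := by
  have hadm : IsLocalMarkovChordalFamily Q :=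
    isLocalMarkovChordalFamily_of_isSLELaw_six_of_facts IsSLELaw.locality_six_holds
      sle_six_moebius_locality_holds hQ
  have hnt := stub_nonTracing Q hQ
  have hseg : ∀ D : DobrushinDomain, ∀ᵐ γ ∂(Q D), ∀ c : Curve ℂ, CurveClass.mk c = γ →
      ∀ s t : unitInterval, s < t → Collinear ℝ (c '' Set.Icc s t) → (c '' Set.Icc s t).Subsingleton :=
    fun D => stub_sleSixNoTracedSegment D (Q D) (hQ D)
  have hnull : ∀ D : DobrushinDomain, ∀ᵐ γ ∂(Q D), volume γ.range = 0 :=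
    fun D => stub_sleRangeNull D (Q D) (hQ D)
  have hend : ∀ D : DobrushinDomain, ∀ᵐ γ ∂(Q D), ∀ c : Curve ℂ, CurveClass.mk c = γ →
      ∀ s t : unitInterval, s ≤ t → c s = D.pt 1 → c t = D.pt 1 :=
    fun D => stub_sleNoEarlyTarget D (Q D) (hQ D)
  refine ⟨fatSurgery Q, ⟨(stub_fatSurgeryChordal Q hadm hnt).1, stub_fatSurgerySimilarity Q hadm,
    stub_fatSurgeryMarkovCore stub_tipSeparationGen stub_slitTrace Q hadm hnt hseg hnull hend,
    stub_fatSurgeryLocal Q hadm, stub_fatSurgeryTI Q hadm⟩, (stub_fatSurgeryChordal Q hadm hnt).2, ?_⟩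
  obtain ⟨D, hfire, hq, hne⟩ :=
    stub_fatSurgeryWitness (stub_fatDomain Literature.Topology.PlaneTopology.exists_osgoodArc)
  exact ⟨D, by rw [fatSurgery_of_eq hfire hq]; exact fun heq => hne Q hseg heq.symm⟩

/-- **The typed crux r2 of route CardyRotToConf is false**: the SLE₆ family and its fat-germ
one-shot surgery are two admissible non-tracing chordal families differing on a Dobrushin domain,
while under the crux both would be the (unique) SLE₆ law. Class: refuted-MISSTATED — the witness
exploits the missing "scaling limit / instant two-sided boundary return" clause; the repaired
statement `C′` adds it and the witness misses `C′`. [folklore] -/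
theorem not_CardyRotToConfR2SymmetryUpgrade :
    ¬ Summit.CriticalPhenomena.CardyFormulaZ2.Theses.CardyRotToConf.CardyRotToConfR2SymmetryUpgrade := by
  obtain ⟨Q, hQ⟩ := exists_sleSixLawFamily'
  have hadm : IsLocalMarkovChordalFamily Q :=
    isLocalMarkovChordalFamily_of_isSLELaw_six_of_facts IsSLELaw.locality_six_holds
      sle_six_moebius_locality_holds hQ
  obtain ⟨J, hJ, hJnt, D, hne⟩ := exists_admissible_nonTracing_ne_of_isSLELaw_six hQ
  exact not_crux_of_two_families hJ hJnt hadm (stub_nonTracing Q hQ) (D := D) hne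

/-- **The same crux as filed on route CardySelfRefinement (`SymmetryUpgrade`, the shared decl of
stmt-CriticalPhenomena-0698) is false** (the two definitions are syntactically identical). [folklore] -/
theorem not_SymmetryUpgrade :
    ¬ Summit.CriticalPhenomena.CardyFormulaZ2.Theses.CardySelfRefinement.SymmetryUpgrade :=
  not_CardyRotToConfR2SymmetryUpgrade

end Summit.CriticalPhenomena.CardyFormulaZ2.Theorems

end
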